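import Summits.Ventures.PercRepro.RLSRulePlus
import Summits.Ventures.PercRepro.RLSPlanarIdentities

/-!
# PercRepro — Theorem 25 for the lifted rule `R₃⁺`: every `3`-point plane satisfies the per-flat inequality at
`(p, 3)` for every `p` (night-3, gen 3)

The `t = 0, P₁` half of the lane (`proofs/N3-R3PLUS-plan.md` §1: «P₁ (3-point flat T): every rank-3 flat F ≠ T of
M|S has ≤ 2 points of T, ≤ 3 independent points of X and no 4-point line, hence type(F) ∈ 𝒯₀, R₃⁺ = R₃ on S, and
Theorem 25 applies verbatim») in the kernel, for the rule `wPlus` of `RLSRulePlus.lean` and EVERY finite matroid: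

* `not_hasLongLine_of_three_point`: a `4`-point subset of `T ∪ X` (`T` a `3`-point plane, `X` independent) never has
  rank `≤ 2` — two of its points would lie in `T`, and a line through two points of `T` lies in `T`;
* `card_inter_le_five_of_three_point`: a plane `G ≠ T` meets `T ∪ X` in at most `2 + 3` points;
* `mstar_union_eq_zero`: so no trace of `T ∪ X` is outside `𝒯₀` and the rule is the basis-count rule there;
* `union_mem_Yq`, `wPlus_union_ge`: for `1 ≤ |X| ≤ p − 4` the set `T ∪ X` is a witness of the middle level and gives
  `T` at least `1 / C(|X| + 3, 3)`;
* `card_UqG_le_one_of_three_point`: the demand of a `3`-point plane is at most `1`, and it is `1` only if `ρ(E ∖ T) = p`,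
  in which case `E ∖ T` has an independent `p`-set `K` to draw the witnesses from;
* **`perFlat_three_point`** — `Φ(p, 3) · #U_T ≤ Σ_{S ∈ Yq} w⁺(T, S)` for every `3`-point plane `T` of every finite
  matroid and every `p`: the witnesses `T ∪ X`, `X ⊆ K`, `1 ≤ |X| ≤ p − 4`, give `Σ_{x=1}^{p−4} C(p, x)/C(x+3, 3)`,
  which is `Φ(p, 3)` by `phiW_eq_phiK_form` (`RLSPlanarIdentities`).
Imports `RLSRulePlus`, `RLSPlanarIdentities`.  Axioms: standard.
-/

open scoped Matroid

namespace PercRepro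

namespace NightThree

open Finset ThmH PerFlat

variable {α : Type*} [DecidableEq α] {M : Matroid α} [M.Finite]

omit [DecidableEq α] in
/-- A plane has rank `3` (numeral form). -/
theorem eRk_eq_three_of_mem_flatsQ' {G : Finset α} (hG : G ∈ flatsQ M 3) : M.eRk (G : Set α) = 3 := by
  rw [flatsQ_three] at hG
  exact (mem_planes.1 hG).2.2

omit [DecidableEq α] [M.Finite] in
/-- A `3`-point set of rank `3` is independent. -/
theorem indep_of_eRk_eq_card_three {T : Finset α} (h3 : M.eRk (T : Set α) = 3) (hc : T.card = 3) :
    M.Indep (T : Set α) := by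
  rw [Matroid.indep_iff_eRk_eq_encard_of_finite T.finite_toSet, h3, Set.encard_coe_eq_coe_finsetCard, hc]
  rfl

omit [DecidableEq α] [M.Finite] in
/-- An independent triple has `ρ₃ = 1`. -/
theorem rho3_eq_one_of_indep_card_three {T : Finset α} (hT : M.Indep (T : Set α)) (hc : T.card = 3) :
    rho3 M T = 1 := by
  classical
  unfold rho3
  rw [← hc, Finset.powersetCard_self, Finset.filter_singleton, if_pos hT, Finset.card_singleton]

omit [DecidableEq α] [M.Finite] in
/-- The rank of an independent finset is its size. -/
theorem eRk_eq_card_of_indep {X : Finset α} (hX : M.Indep (X : Set α)) : M.eRk (X : Set α) = X.card := by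
  rw [hX.eRk_eq_encard, Set.encard_coe_eq_coe_finsetCard]

/-- **No long line in `T ∪ X`.**  For a `3`-point plane `T` and an independent `X` disjoint from `T`, no `4`-point
subset of `T ∪ X` has rank `≤ 2`. -/
theorem not_hasLongLine_of_three_point {T X : Finset α} (hT : T ∈ flatsQ M 3) (hTc : T.card = 3)
    (hX : M.Indep (X : Set α)) {F : Finset α} (hF : F ⊆ T ∪ X) :
    ¬ HasLongLine M F := by
  rintro ⟨L, hL, hr⟩
  rw [Finset.mem_powersetCard] at hL
  obtain ⟨hLF, hLc⟩ := hL
  have hLTX : L ⊆ T ∪ X := hLF.trans hF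
  have hTE : (T : Set α) ⊆ M.E := by rw [← coe_gr M]; exact Finset.coe_subset.2 (mem_flatsQ.1 hT).1
  have hLE : (L : Set α) ⊆ M.E := by
    refine (Finset.coe_subset.2 hLTX).trans ?_
    rw [Finset.coe_union]
    exact Set.union_subset hTE hX.subset_ground
  -- at most two points of `L` lie in `X`
  have hLX : (L ∩ X).card ≤ 2 := by
    have hind : M.Indep ((L ∩ X : Finset α) : Set α) :=
      hX.subset (Finset.coe_subset.2 Finset.inter_subset_right)
    have h2 : M.eRk ((L ∩ X : Finset α) : Set α) ≤ 2 :=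
      (M.eRk_mono (Finset.coe_subset.2 Finset.inter_subset_left)).trans hr
    rw [eRk_eq_card_of_indep hind] at h2
    exact_mod_cast h2
  -- so at least two lie in `T`
  have hLT : 2 ≤ (L ∩ T).card := by
    have hsplit : L = (L ∩ T) ∪ (L ∩ X) := by
      rw [← Finset.inter_union_distrib_left, Finset.inter_eq_left.2 hLTX]
    have hc := Finset.card_union_le (L ∩ T) (L ∩ X)
    rw [← hsplit, hLc] at hc
    omega
  obtain ⟨P, hPsub, hPc⟩ := Finset.exists_subset_card_eq hLT
  have hPT : P ⊆ T := hPsub.trans Finset.inter_subset_right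
  have hPL : P ⊆ L := hPsub.trans Finset.inter_subset_left
  have hTind : M.Indep (T : Set α) := indep_of_eRk_eq_card_three (eRk_eq_three_of_mem_flatsQ' hT) hTc
  have hPr : M.eRk (P : Set α) = 2 := by
    rw [eRk_eq_card_of_indep (hTind.subset (Finset.coe_subset.2 hPT)), hPc]
    rfl
  -- the line `L` lies in the closure of the two points `P ⊆ T`, hence in `T`
  have hcl : M.closure (P : Set α) = M.closure (L : Set α) := by
    apply closure_eq_of_subset_flat (M.isFlat_closure _)
      ((Finset.coe_subset.2 hPL).trans (M.subset_closure _ hLE)) P.finite_toSet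
    rw [M.eRk_closure_eq, hPr]
    exact hr
  have hTflat : M.IsFlat (T : Set α) := (mem_flatsQ.1 hT).2.1
  have hLsub : (L : Set α) ⊆ (T : Set α) :=
    calc (L : Set α) ⊆ M.closure (L : Set α) := M.subset_closure _ hLE
      _ = M.closure (P : Set α) := hcl.symm
      _ ⊆ M.closure (T : Set α) := M.closure_subset_closure (Finset.coe_subset.2 hPT)
      _ = (T : Set α) := hTflat.closure
  have := Finset.card_le_card (Finset.coe_subset.1 hLsub)
  omega

/-- A plane `G ≠ T` meets `T ∪ X` in at most `5` points (`≤ 2` of `T`, `≤ 3` of the independent `X`). -/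
theorem card_inter_le_five_of_three_point {T X G : Finset α} (hT : T ∈ flatsQ M 3) (hTc : T.card = 3)
    (hX : M.Indep (X : Set α)) (hG : G ∈ flatsQ M 3) (hne : G ≠ T) : (G ∩ (T ∪ X)).card ≤ 5 := by
  have hT3 : M.eRk (T : Set α) = 3 := eRk_eq_three_of_mem_flatsQ' hT
  have hG3 : M.eRk (G : Set α) = 3 := eRk_eq_three_of_mem_flatsQ' hG
  have h1 : (G ∩ T).card ≤ 2 := by
    by_contra h
    push Not at h
    have hTG : T ⊆ G := by
      have heq : G ∩ T = T :=
        Finset.eq_of_subset_of_card_le Finset.inter_subset_right (by rw [hTc]; omega)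
      rw [← heq]
      exact Finset.inter_subset_left
    rw [flatsQ_three] at hG hT
    exact hne (planes_eq_of_subset hG hT hTG le_rfl hT3)
  have h2 : (G ∩ X).card ≤ 3 := by
    have hind : M.Indep ((G ∩ X : Finset α) : Set α) :=
      hX.subset (Finset.coe_subset.2 Finset.inter_subset_right)
    have h2' : M.eRk ((G ∩ X : Finset α) : Set α) ≤ 3 := by
      rw [← hG3]
      exact M.eRk_mono (Finset.coe_subset.2 Finset.inter_subset_left)
    rw [eRk_eq_card_of_indep hind] at h2'
    exact_mod_cast h2'
  calc (G ∩ (T ∪ X)).card = ((G ∩ T) ∪ (G ∩ X)).card := by rw [Finset.inter_union_distrib_left]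
    _ ≤ (G ∩ T).card + (G ∩ X).card := Finset.card_union_le _ _
    _ ≤ 5 := by omega

/-- **Every trace of `T ∪ X` is in `𝒯₀`**: `m*(T ∪ X) = 0`. -/
theorem mstar_union_eq_zero {T X : Finset α} (hT : T ∈ flatsQ M 3) (hTc : T.card = 3)
    (hX : M.Indep (X : Set α)) : mstar M (T ∪ X) = 0 := by
  rw [mstar_eq_zero_iff]
  intro G hG hn
  obtain ⟨_, hbig⟩ := hn
  rcases hbig with h6 | hline
  · by_cases hGT : G = T
    · have h3 : (G ∩ (T ∪ X)).card ≤ 3 := by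
        rw [hGT, Finset.inter_eq_left.2 Finset.subset_union_left]
        exact hTc.le
      omega
    · have := card_inter_le_five_of_three_point hT hTc hX hG hGT
      omega
  · exact not_hasLongLine_of_three_point hT hTc hX Finset.inter_subset_right hline

/-- `T ∪ X` is a witness of the middle level at `(p, 3)` when `1 ≤ |X|` and `|X| + 4 ≤ p`. -/
theorem union_mem_Yq {T X : Finset α} (hT : T ∈ flatsQ M 3) (hX : M.Indep (X : Set α))
    (hXT : Disjoint X T) {p : ℕ} (h1 : 1 ≤ X.card) (h2 : X.card + 4 ≤ p) : T ∪ X ∈ Yq M p 3 := by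
  have hT3 : M.eRk (T : Set α) = 3 := eRk_eq_three_of_mem_flatsQ' hT
  unfold Yq
  rw [Finset.mem_filter, Finset.mem_powerset]
  refine ⟨?_, ?_, ?_⟩
  · apply Finset.union_subset (mem_flatsQ.1 hT).1
    rw [← Finset.coe_subset, coe_gr]
    exact hX.subset_ground
  · obtain ⟨x, hx⟩ := Finset.card_pos.1 h1
    have hxE : x ∈ M.E := hX.subset_ground (Finset.mem_coe.2 hx)
    have hxT : x ∉ (T : Set α) := by
      rw [Finset.mem_coe]
      exact Finset.disjoint_left.1 hXT hx
    have hTflat : M.IsFlat (T : Set α) := (mem_flatsQ.1 hT).2.1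
    have hins : M.eRk (insert x (T : Set α)) = 4 := by
      rw [Matroid.eRk_insert_eq_add_one ⟨hxE, by rw [hTflat.closure]; exact hxT⟩, hT3]
      rfl
    have hsub : insert x (T : Set α) ⊆ ((T ∪ X : Finset α) : Set α) := by
      rw [Finset.coe_union]
      exact Set.insert_subset (Set.mem_union_right _ (Finset.mem_coe.2 hx)) Set.subset_union_left
    have h4 := M.eRk_mono hsub
    rw [hins] at h4
    exact lt_of_lt_of_le (by norm_num) h4
  · calc M.eRk ((T ∪ X : Finset α) : Set α) ≤ M.eRk (T : Set α) + M.eRk (X : Set α) := by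
          rw [Finset.coe_union]
          exact M.eRk_union_le_eRk_add_eRk _ _
      _ = 3 + (X.card : ℕ∞) := by rw [hT3, eRk_eq_card_of_indep hX]
      _ < (p : ℕ∞) := by
          have : ((3 + X.card : ℕ) : ℕ∞) < (p : ℕ∞) := by exact_mod_cast (by omega : 3 + X.card < p)
          simpa using this

/-- **The share of `T` in `T ∪ X`** is at least `1 / C(3 + |X|, 3)`. -/
theorem wPlus_union_ge {T X : Finset α} (hT : T ∈ flatsQ M 3) (hTc : T.card = 3)
    (hX : M.Indep (X : Set α)) (hXT : Disjoint X T) :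
    1 / (((3 + X.card).choose 3 : ℕ) : ℚ) ≤ wPlus M T (T ∪ X) := by
  have hS : T ∪ X ⊆ gr M := by
    apply Finset.union_subset (mem_flatsQ.1 hT).1
    rw [← Finset.coe_subset, coe_gr]
    exact hX.subset_ground
  have hTind : M.Indep (T : Set α) := indep_of_eRk_eq_card_three (eRk_eq_three_of_mem_flatsQ' hT) hTc
  have h := wPlus_ge_of_mstar_zero hS (mstar_union_eq_zero hT hTc hX) T
  rw [Finset.inter_eq_left.2 Finset.subset_union_left, rho3_eq_one_of_indep_card_three hTind hTc,
    Finset.card_union_of_disjoint hXT.symm, hTc, Nat.cast_one] at h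
  exact h

/-- The demand of a `3`-point plane is at most `1` (only `T` itself can be a bottom set inside `T`). -/
theorem card_UqG_le_one_of_three_point {T : Finset α} (hTc : T.card = 3) (p : ℕ) :
    (UqG M p 3 T).card ≤ 1 := by
  rw [Finset.card_le_one]
  have key : ∀ B ∈ UqG M p 3 T, B = T := by
    intro B hB
    unfold UqG at hB
    rw [Finset.mem_filter, mem_Uq] at hB
    have hB3 : M.eRk (B : Set α) = 3 := by exact_mod_cast hB.1.2.1
    apply Finset.eq_of_subset_of_card_le hB.2
    have := three_le_card_of_eRk_eq_three hB3
    omega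
  intro B hB B' hB'
  rw [key B hB, key B' hB']

/-- **Theorem 25 for `R₃⁺` (`t = 0`, `P₁`).**  Every `3`-point plane `T` of every finite matroid satisfies the
per-flat inequality at `(p, 3)` for every `p`: `Φ(p, 3) · #U_T ≤ Σ_{S ∈ Yq} w⁺(T, S)`. -/
theorem perFlat_three_point {T : Finset α} (hT : T ∈ flatsQ M 3) (hTc : T.card = 3) (p : ℕ) :
    phiK p 3 * ((UqG M p 3 T).card : ℚ) ≤ ∑ S ∈ Yq M p 3, wPlus M T S := by
  classical
  have hsupply : 0 ≤ ∑ S ∈ Yq M p 3, wPlus M T S := Finset.sum_nonneg (fun S _ => wPlus_nonneg M T S)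
  rcases Finset.eq_empty_or_nonempty (UqG M p 3 T) with hU | ⟨B, hB⟩
  · rw [hU, Finset.card_empty, Nat.cast_zero, mul_zero]
    exact hsupply
  have hcard : (UqG M p 3 T).card = 1 :=
    le_antisymm (card_UqG_le_one_of_three_point hTc p) (Finset.card_pos.2 ⟨B, hB⟩)
  rw [hcard, Nat.cast_one, mul_one]
  -- the bottom set is `T` itself, so `ρ(E ∖ T) = p`
  have hBT : B = T := by
    unfold UqG at hB
    rw [Finset.mem_filter, mem_Uq] at hB
    have hB3 : M.eRk (B : Set α) = 3 := by exact_mod_cast hB.1.2.1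
    apply Finset.eq_of_subset_of_card_le hB.2
    have := three_le_card_of_eRk_eq_three hB3
    omega
  have hrank : M.eRk ((gr M \ T : Finset α) : Set α) = p := by
    unfold UqG at hB
    rw [Finset.mem_filter, mem_Uq] at hB
    rw [← hBT]
    exact hB.1.2.2
  rcases lt_or_ge p 4 with hp | hp
  · have h0 : phiK p 3 = 0 := by
      unfold phiK
      rw [Finset.Ioo_eq_empty_of_le (by omega), Finset.sum_empty, zero_div]
    rw [h0]
    exact hsupply
  obtain ⟨n, rfl⟩ : ∃ n, p = n + 4 := ⟨p - 4, by omega⟩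
  -- an independent `p`-subset `K` of `E ∖ T`
  have hsubE : ((gr M \ T : Finset α) : Set α) ⊆ M.E := by
    rw [← coe_gr M]
    exact Finset.coe_subset.2 Finset.sdiff_subset
  obtain ⟨I, hI⟩ := M.exists_isBasis _ hsubE
  have hIfin : I.Finite := (gr M \ T).finite_toSet.subset hI.subset
  have hKI : (hIfin.toFinset : Set α) = I := hIfin.coe_toFinset
  have hKind : M.Indep (hIfin.toFinset : Set α) := by rw [hKI]; exact hI.indep
  have hKT : Disjoint hIfin.toFinset T := by
    rw [Finset.disjoint_left]
    intro x hxK hxT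
    have hxI : x ∈ I := by rw [← hKI]; exact Finset.mem_coe.2 hxK
    have hx := hI.subset hxI
    rw [Finset.coe_sdiff, Set.mem_sdiff] at hx
    exact hx.2 (Finset.mem_coe.2 hxT)
  have hKcard : hIfin.toFinset.card = n + 4 := by
    have h1 := hI.encard_eq_eRk
    rw [hrank, ← hKI, Set.encard_coe_eq_coe_finsetCard] at h1
    exact_mod_cast h1
  set K := hIfin.toFinset with hK
  -- the witness family: the subsets of `K` of size `1 … n`
  set W : Finset (Finset α) := (Finset.Ico 1 (n + 1)).biUnion (fun x => K.powersetCard x) with hW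
  have hWmem : ∀ X ∈ W, X ⊆ K ∧ 1 ≤ X.card ∧ X.card ≤ n := by
    intro X hX
    rw [hW, Finset.mem_biUnion] at hX
    obtain ⟨x, hx, hXx⟩ := hX
    rw [Finset.mem_Ico] at hx
    rw [Finset.mem_powersetCard] at hXx
    exact ⟨hXx.1, by omega, by omega⟩
  have himg : W.image (fun X => T ∪ X) ⊆ Yq M (n + 4) 3 := by
    intro S hS
    rw [Finset.mem_image] at hS
    obtain ⟨X, hXW, rfl⟩ := hS
    obtain ⟨hXK, h1, h2⟩ := hWmem X hXW
    exact union_mem_Yq hT (hKind.subset (Finset.coe_subset.2 hXK))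
      (Finset.disjoint_of_subset_left hXK hKT) h1 (by omega)
  have hinj : Set.InjOn (fun X => T ∪ X) (W : Set (Finset α)) := by
    intro X hX X' hX' h
    have hXT : Disjoint T X := (Finset.disjoint_of_subset_left (hWmem X hX).1 hKT).symm
    have hXT' : Disjoint T X' := (Finset.disjoint_of_subset_left (hWmem X' hX').1 hKT).symm
    have h' : T ∪ X = T ∪ X' := h
    rw [← Finset.union_sdiff_cancel_left hXT, h', Finset.union_sdiff_cancel_left hXT']
  have hWdisj : Set.PairwiseDisjoint (↑(Finset.Ico 1 (n + 1)) : Set ℕ) (fun x => K.powersetCard x) :=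
    K.pairwise_disjoint_powersetCard.set_pairwise _
  -- the witness sum is `Φ(p, 3)`
  have hsum : ∑ X ∈ W, 1 / (((3 + X.card).choose 3 : ℕ) : ℚ) = phiK (n + 4) 3 := by
    rw [hW, Finset.sum_biUnion hWdisj]
    have hinner : ∀ x ∈ Finset.Ico 1 (n + 1),
        ∑ X ∈ K.powersetCard x, 1 / (((3 + X.card).choose 3 : ℕ) : ℚ) =
          ((n + 4).choose x : ℚ) / (((3 + x).choose 3 : ℕ) : ℚ) := by
      intro x _
      rw [Finset.sum_congr rfl (fun X hX => by
        rw [(Finset.mem_powersetCard.1 hX).2]), Finset.sum_const, Finset.card_powersetCard, hKcard,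
        nsmul_eq_mul, mul_one_div]
    rw [Finset.sum_congr rfl hinner, Finset.sum_Ico_eq_sum_range]
    unfold phiK
    rw [phiW_eq_phiK_form n]
    unfold phiW
    rw [show n + 1 - 1 = n from rfl]
    apply Finset.sum_congr rfl
    intro i _
    rw [show 1 + i = i + 1 by omega, show 3 + (i + 1) = i + 4 by omega]
  calc phiK (n + 4) 3 = ∑ X ∈ W, 1 / (((3 + X.card).choose 3 : ℕ) : ℚ) := hsum.symm
    _ ≤ ∑ X ∈ W, wPlus M T (T ∪ X) := by
        apply Finset.sum_le_sum
        intro X hX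
        exact wPlus_union_ge hT hTc (hKind.subset (Finset.coe_subset.2 (hWmem X hX).1))
          (Finset.disjoint_of_subset_left (hWmem X hX).1 hKT)
    _ = ∑ S ∈ W.image (fun X => T ∪ X), wPlus M T S := (Finset.sum_image hinj).symm
    _ ≤ ∑ S ∈ Yq M (n + 4) 3, wPlus M T S :=
        Finset.sum_le_sum_of_subset_of_nonneg himg (fun S _ _ => wPlus_nonneg M T S)

end NightThree

end PercRepro
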